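import Mathlib
import HarnessLib
import Literature.Analysis.FluidPDE.VectorCalculus
import Literature.Analysis.FluidPDE.VorticityCalculus
import Literature.Analysis.FluidPDE.TaoEnstrophyLocalisation
import Literature.Analysis.FluidPDE.IsometryInvariance
import Literature.Analysis.FluidPDE.AxisymmetricEuler
import Literature.Analysis.FluidPDE.SwirlTransportProofs
import Literature.Analysis.FluidPDE.AxisymmetricVorticityTransport
import Literature.Analysis.FluidPDE.AxisymmetricReflection
import Literature.Analysis.FluidPDE.AxisymNoSwirlVorticity
import Literature.Analysis.FluidPDE.KNSSSwirlFromVorticity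
import Literature.Analysis.FluidPDE.KNSSTypeIRateSelection
import Summits.NavierStokesRegularity.NavierStokesRegularity.Theorems.UnthreadedDoorNetFluxDefs

/-!
# Route `UnthreadedDoor`, crux `PoloidalLiouville` (stmt-NavierStokesRegularity-1222), WALL W1 — cell-flux Z skeleton, stub Z-1b `AxisFrozen`:
# STATICS in the straightened frame (`Cruxes/PoloidalLiouville/CellFluxZSkeleton.lean` v1.1 c6ae0be7f8d8; custodian ns-idea-14, critic V22)

Frame-level kinematic facts used by the dynamic axis-freezing argument (`UnthreadedDoorCellFluxAxisFrozen*.lean`), all about smooth fields on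
`ℝ³` and the meridian reflection `σ = reflY` (`(x₀, x₁, x₂) ↦ (x₀, −x₁, x₂)`):

* `curl_reflY_conj`: the vorticity is a pseudovector under `σ`: `curl (σ ∘ u ∘ σ) (x) = −σ (curl u (σ x))` (coordinates);
* the VORTICITY NONLINEARITY `N(u) := ((curl u)·∇)u − (u·∇)(curl u) + Δ(curl u)` (so that the vorticity equation reads `∂ₜω = N(u(t))`; written
  out, no new definition): `vortN_add_const` — `N(u + d) = N(u) − D(curl u)·d` for a constant `d`; `vortN_reflY_conj` — `N(σuσ)(y) = −σ N(u)(σ y)`;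
  `vortN_rotZ` — `N(W)` is an axisymmetric vector field when `W` is axisymmetric; `vortN_azimuthal` — for `W` axisymmetric WITHOUT swirl,
  `N(W)(y)` is azimuthal at every point: `N(W)(y)₂ = 0` and `⟪y, N(W)(y)⟫ = 0` (at meridian points `σ y = y` and `σ N(W)(y) = −N(W)(y)`;
  general points by rotation);
* `inner_curl_eq_zero_of_noSwirl`, `curl_two_of_noSwirl`: the vorticity of an axisymmetric swirl-free field is azimuthal (tree facts repackaged);
* `horizontal_eq_zero_of_forall_inner_curl` (UNIQUENESS OF THE ZONAL DIRECTION): if `curl W ≢ 0` for `W` axisymmetric swirl-free, a vector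
  orthogonal to every `curl W (y)` is vertical;
* `inner_eq_zero_of_horizontal_span` (two independent horizontal vectors span the horizontal plane, Cramer) and the Lagrange identities
  `sq_det_eq_of_horizontal` (the `ℝ³` Lagrange identity is the tree's `HorizonTower.Zonal.norm_cross_sq`).

WHAT THIS IS NOT: kinematics only; `PoloidalLiouville` (1222), Z, W1 and NS regularity stay OPEN.  `--supports stmt-NavierStokesRegularity-1222 --as helper`.
[folklore]
-/

noncomputable section

-- the summit and its single sub-problem share the name (CONVENTIONS §1)
set_option linter.dupNamespace false

open Set Function Filter Topology MeasureTheory Metric InnerProductSpace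
open scoped RealInnerProductSpace Laplacian InnerProductSpace

namespace Summit.NavierStokesRegularity.NavierStokesRegularity.Theorems.PoloidalLiouville.CellFlux

open Summit.NavierStokesRegularity.NavierStokesRegularity.Theorems.PoloidalLiouville.NetFlux (E3)
open Literature.Analysis Literature.Analysis.FluidPDE

/-! ### §1 The curl under the meridian reflection -/

/-- `σ e₀ = e₀`. -/
theorem reflY_single_zero : reflY (EuclideanSpace.single 0 (1 : ℝ)) = EuclideanSpace.single 0 (1 : ℝ) := by
  ext i
  fin_cases i <;> simp

/-- `σ e₁ = −e₁`. -/
theorem reflY_single_one : reflY (EuclideanSpace.single 1 (1 : ℝ)) = -EuclideanSpace.single 1 (1 : ℝ) := by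
  ext i
  fin_cases i <;> simp

/-- `σ e₂ = e₂` (the axis lies in the mirror). -/
theorem reflY_single_two : reflY (EuclideanSpace.single 2 (1 : ℝ)) = EuclideanSpace.single 2 (1 : ℝ) := by
  ext i
  fin_cases i <;> simp

/-- **The curl vector of a `σ`-conjugated Jacobian**: `curlCLM (σ ∘ A ∘ σ) = −σ (curlCLM A)` (the meridian reflection has determinant `−1`;
direct coordinate check). [folklore] -/
theorem curlCLM_reflY_conj (A : E3 →L[ℝ] E3) :
    curlCLM (((reflY : E3 ≃ₗᵢ[ℝ] E3) : E3 →L[ℝ] E3).comp (A.comp ((reflY : E3 ≃ₗᵢ[ℝ] E3) : E3 →L[ℝ] E3))) =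
      -reflY (curlCLM A) := by
  have e : ∀ v : E3, (((reflY : E3 ≃ₗᵢ[ℝ] E3) : E3 →L[ℝ] E3).comp (A.comp ((reflY : E3 ≃ₗᵢ[ℝ] E3) : E3 →L[ℝ] E3))) v =
      reflY (A (reflY v)) := fun v => rfl
  have h : curlCLM (((reflY : E3 ≃ₗᵢ[ℝ] E3) : E3 →L[ℝ] E3).comp (A.comp ((reflY : E3 ≃ₗᵢ[ℝ] E3) : E3 →L[ℝ] E3))) =
      WithLp.toLp 2 ![reflY (A (reflY (EuclideanSpace.single 1 1))) 2 - reflY (A (reflY (EuclideanSpace.single 2 1))) 1,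
        reflY (A (reflY (EuclideanSpace.single 2 1))) 0 - reflY (A (reflY (EuclideanSpace.single 0 1))) 2,
        reflY (A (reflY (EuclideanSpace.single 0 1))) 1 - reflY (A (reflY (EuclideanSpace.single 1 1))) 0] := rfl
  have h' : curlCLM A = WithLp.toLp 2 ![A (EuclideanSpace.single 1 1) 2 - A (EuclideanSpace.single 2 1) 1,
      A (EuclideanSpace.single 2 1) 0 - A (EuclideanSpace.single 0 1) 2,
      A (EuclideanSpace.single 0 1) 1 - A (EuclideanSpace.single 1 1) 0] := rfl
  rw [h, h', reflY_single_zero, reflY_single_one, reflY_single_two, map_neg]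
  ext i
  fin_cases i <;> simp [reflY] <;> ring

/-- **The vorticity is a pseudovector under the meridian reflection**: `curl (σ ∘ u ∘ σ)(x) = −σ (curl u (σ x))`, no differentiability hypothesis
(junk values transform alike). [folklore] -/
theorem curl_reflY_conj (u : E3 → E3) (x : E3) :
    curl (fun y => reflY (u (reflY y))) x = -reflY (curl u (reflY x)) := by
  have h1 : (fun y => reflY (u (reflY y))) = fun y => reflY (u (reflY.symm y)) := by
    simp only [reflY_symm]
  rw [curl_eq_curlCLM, curl_eq_curlCLM, h1, fderiv_conj_linearIsometryEquiv, reflY_symm, curlCLM_reflY_conj]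

/-! ### §2 The vorticity nonlinearity `N(u) = ((curl u)·∇)u − (u·∇)(curl u) + Δ (curl u)` -/

/-- **`N(u + d) = N(u) − D(curl u)·d`** for a constant vector `d` (the curl and the Jacobian do not see the constant; only the transport term does).
[folklore] -/
theorem vortN_add_const (u : E3 → E3) (d y : E3) :
    convect (curl fun z => u z + d) (fun z => u z + d) y - convect (fun z => u z + d) (curl fun z => u z + d) y +
        (Δ (curl fun z => u z + d)) y =
      (convect (curl u) u y - convect u (curl u) y + (Δ (curl u)) y) - fderiv ℝ (curl u) y d := by
  have hc : (curl fun z => u z + d) = curl u := by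
    funext z
    rw [curl_eq_curlCLM, curl_eq_curlCLM, fderiv_add_const]
  rw [hc]
  simp only [convect_apply, fderiv_add_const, map_add]
  abel

/-- **`N(σ u σ)(y) = −σ N(u)(σ y)`**: the vorticity nonlinearity is a pseudovector under the meridian reflection (for `u` of class `C³`, so that
`curl u` is `C²`). [folklore] -/
theorem vortN_reflY_conj {u : E3 → E3} (hu : ContDiff ℝ 3 u) (y : E3) :
    convect (curl fun z => reflY (u (reflY z))) (fun z => reflY (u (reflY z))) y -
        convect (fun z => reflY (u (reflY z))) (curl fun z => reflY (u (reflY z))) y +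
        (Δ (curl fun z => reflY (u (reflY z)))) y =
      -reflY (convect (curl u) u (reflY y) - convect u (curl u) (reflY y) + (Δ (curl u)) (reflY y)) := by
  set ω : E3 → E3 := curl u with hω
  have hω2 : ContDiff ℝ 2 ω := contDiff_curl (n := 2) (by exact_mod_cast hu)
  -- the curl of the conjugated field is the conjugate of `-ω`
  have hc : (curl fun z => reflY (u (reflY z))) = fun z => reflY ((fun w => -ω w) (reflY.symm z)) := by
    funext z
    rw [curl_reflY_conj, reflY_symm, map_neg]
  have hud : ∀ z, DifferentiableAt ℝ u z := fun z => (hu.differentiable (by norm_num)) z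
  -- the Jacobian of the conjugated velocity
  have hDu : fderiv ℝ (fun z => reflY (u (reflY z))) y =
      ((reflY : E3 ≃ₗᵢ[ℝ] E3) : E3 →L[ℝ] E3).comp ((fderiv ℝ u (reflY y)).comp ((reflY : E3 ≃ₗᵢ[ℝ] E3) : E3 →L[ℝ] E3)) := by
    have := fderiv_conj_linearIsometryEquiv reflY u y
    simpa only [reflY_symm] using this
  -- the Jacobian of the conjugated vorticity
  have hDω : fderiv ℝ (fun z => reflY ((fun w => -ω w) (reflY.symm z))) y =
      ((reflY : E3 ≃ₗᵢ[ℝ] E3) : E3 →L[ℝ] E3).comp ((fderiv ℝ (fun w => -ω w) (reflY y)).comp ((reflY : E3 ≃ₗᵢ[ℝ] E3) : E3 →L[ℝ] E3)) := by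
    have := fderiv_conj_linearIsometryEquiv reflY (fun w => -ω w) y
    simpa only [reflY_symm] using this
  have hneg : fderiv ℝ (fun w => -ω w) (reflY y) = -fderiv ℝ ω (reflY y) := fderiv_fun_neg
  -- the Laplacian of the conjugated vorticity
  have hΔ : (Δ (fun z => reflY ((fun w => -ω w) (reflY.symm z)))) y = -reflY ((Δ ω) (reflY y)) := by
    rw [laplacian_conj_linearIsometryEquiv reflY (fun w => -ω w) y, reflY_symm]
    have : (fun w => -ω w) = -ω := rfl
    rw [this, InnerProductSpace.laplacian_neg, Pi.neg_apply, map_neg]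
  rw [hc]
  simp only [convect_apply]
  rw [hDu, hDω, hneg, hΔ]
  simp only [ContinuousLinearMap.comp_apply, reflY_symm, neg_apply, map_neg]
  have e1 : ∀ v : E3, ((reflY : E3 ≃ₗᵢ[ℝ] E3) : E3 →L[ℝ] E3) v = reflY v := fun v => rfl
  simp only [e1, reflY_reflY, map_add, map_sub]
  abel

/-- **`N(W)` is an axisymmetric vector field for axisymmetric `W`** (of class `C³`): `N(W)(R_θ y) = R_θ N(W)(y)` — the Jacobians of `W` and of
`curl W` are rotation-equivariant (`IsAxisymmetric.fderiv_rotZ`) and the Laplacian commutes with rotations (`IsAxisymmetric.laplacian_rotZ`).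
[folklore] -/
theorem vortN_rotZ {W : E3 → E3} (hax : IsAxisymmetric W) (hW : ContDiff ℝ 3 W) (θ : ℝ) (y : E3) :
    convect (curl W) W (rotZ θ y) - convect W (curl W) (rotZ θ y) + (Δ (curl W)) (rotZ θ y) =
      rotZ θ (convect (curl W) W y - convect W (curl W) y + (Δ (curl W)) y) := by
  have hWd : Differentiable ℝ W := hW.differentiable (by norm_num)
  have hω2 : ContDiff ℝ 2 (curl W) := contDiff_curl (n := 2) (by exact_mod_cast hW)
  have hωd : Differentiable ℝ (curl W) := hω2.differentiable (by norm_num)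
  have hωax : IsAxisymmetric (curl W) := hax.curl hWd
  have h1 : convect (curl W) W (rotZ θ y) = rotZ θ (convect (curl W) W y) := by
    simp only [convect_apply]
    rw [hax.fderiv_rotZ hWd θ y, hωax θ y]
    simp only [ContinuousLinearMap.comp_apply, rotZL_apply]
    rw [← rotZ_add, neg_add_cancel, rotZ_zero]
  have h2 : convect W (curl W) (rotZ θ y) = rotZ θ (convect W (curl W) y) := by
    simp only [convect_apply]
    rw [hωax.fderiv_rotZ hωd θ y, hax θ y]
    simp only [ContinuousLinearMap.comp_apply, rotZL_apply]
    rw [← rotZ_add, neg_add_cancel, rotZ_zero]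
  have h3 : (Δ (curl W)) (rotZ θ y) = rotZ θ ((Δ (curl W)) y) := hωax.laplacian_rotZ θ y
  rw [h1, h2, h3, ← rotZL_apply, ← rotZL_apply, ← rotZL_apply, ← rotZL_apply, map_add, map_sub]

/-- **`N(W)` is azimuthal for axisymmetric swirl-free `W`** (class `C³`): `N(W)(y)₂ = 0` and `⟪y, N(W)(y)⟫ = 0` at every point.  At a meridian point
(`y₁ = 0`, so `σ y = y`) the reflection symmetry `σ W σ = W` and `vortN_reflY_conj` give `N(W)(y) = −σ N(W)(y)`, i.e. `N(W)(y) ∈ ℝ e₁ ⊥ {e₂, y}`;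
a general point is a rotation of a meridian point (`exists_rotZ_eq_single_add_smul`) and `N(W)` is rotation-equivariant (`vortN_rotZ`). [folklore] -/
theorem vortN_azimuthal {W : E3 → E3} (hax : IsAxisymmetric W) (hsw : HasNoSwirl W) (hW : ContDiff ℝ 3 W) (y : E3) :
    (convect (curl W) W y - convect W (curl W) y + (Δ (curl W)) y) 2 = 0 ∧
      ⟪y, convect (curl W) W y - convect W (curl W) y + (Δ (curl W)) y⟫ = 0 := by
  -- meridian points first
  have hmer : ∀ m : E3, m 1 = 0 →
      (convect (curl W) W m - convect W (curl W) m + (Δ (curl W)) m) 2 = 0 ∧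
        ⟪m, convect (curl W) W m - convect W (curl W) m + (Δ (curl W)) m⟫ = 0 := by
    intro m hm
    set Nv : E3 := convect (curl W) W m - convect W (curl W) m + (Δ (curl W)) m with hNv
    have hfix : reflY m = m := by
      ext i
      fin_cases i <;> simp [hm]
    have hconj : (fun z => reflY (W (reflY z))) = W := by
      funext z
      have := hax.conj_reflY_eq hsw z
      rwa [reflY_symm] at this
    have key := vortN_reflY_conj hW m
    rw [hconj, hfix] at key
    -- key : Nv = -reflY Nv
    have k0 : Nv 0 = 0 := by
      have := congrArg (fun v : E3 => v 0) key
      simp only [PiLp.neg_apply, reflY_apply_zero] at this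
      linarith
    have k2 : Nv 2 = 0 := by
      have := congrArg (fun v : E3 => v 2) key
      simp only [PiLp.neg_apply, reflY_apply_two] at this
      linarith
    refine ⟨k2, ?_⟩
    simp only [PiLp.inner_apply, RCLike.inner_apply, conj_trivial, Fin.sum_univ_three, k0, k2, hm]
    ring
  -- general point: rotate to the meridian half-plane
  obtain ⟨θ, hθ⟩ := exists_rotZ_eq_single_add_smul y
  set m : E3 := EuclideanSpace.single 2 (y 2) + cylRadius y • EuclideanSpace.single 0 1 with hmdef
  have hm1 : m 1 = 0 := by simp [hmdef]
  have hy : y = rotZ (-θ) m := by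
    rw [← hθ, ← rotZ_add, neg_add_cancel, rotZ_zero]
  obtain ⟨hA, hB⟩ := hmer m hm1
  rw [hy, vortN_rotZ hax hW (-θ) m]
  refine ⟨by simpa using hA, ?_⟩
  rw [← rotZL_apply, ← rotZL_apply]
  have : ⟪(rotZL (-θ)) m, (rotZL (-θ)) (convect (curl W) W m - convect W (curl W) m + (Δ (curl W)) m)⟫ =
      ⟪m, convect (curl W) W m - convect W (curl W) m + (Δ (curl W)) m⟫ := by
    simp only [rotZL_apply]
    rw [← rotZLIE_apply, ← rotZLIE_apply, LinearIsometryEquiv.inner_map_map]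
  rw [this, hB]

/-! ### §3 The vorticity of an axisymmetric swirl-free field is azimuthal; uniqueness of the zonal direction -/

/-- `⟪y, curl W (y)⟫ = 0` for axisymmetric swirl-free `C¹` fields (tree: `ω_r = 0`, `ω_z = 0`). [folklore] -/
theorem inner_curl_eq_zero_of_noSwirl {W : E3 → E3} (hax : IsAxisymmetric W) (hsw : HasNoSwirl W) (hW : ContDiff ℝ 1 W) (y : E3) :
    ⟪y, curl W y⟫ = 0 := by
  have hd : DifferentiableAt ℝ W y := (hW.differentiable one_ne_zero) y
  have h1 := inner_curl_horizontal_eq_zero hax hsw hd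
  have h2 := curl_apply_two_eq_zero hax hsw hW y
  simp only [PiLp.inner_apply, RCLike.inner_apply, conj_trivial, Fin.sum_univ_three, h2]
  linarith

/-- **Uniqueness of the zonal direction.**  If `W` is axisymmetric, swirl free and `C¹` with `curl W (y₀) ≠ 0` somewhere, then a vector `d` orthogonal
to every `curl W (y)` is vertical (`d₀ = d₁ = 0`): `curl W (R_{π/2} y₀) = R_{π/2} (curl W (y₀))` is a second, independent horizontal vector.
[folklore] -/
theorem horizontal_eq_zero_of_forall_inner_curl {W : E3 → E3} (hax : IsAxisymmetric W) (hsw : HasNoSwirl W) (hW : ContDiff ℝ 1 W)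
    {y₀ : E3} (hy₀ : curl W y₀ ≠ 0) {d : E3} (hd : ∀ y, ⟪d, curl W y⟫ = 0) : d 0 = 0 ∧ d 1 = 0 := by
  have hWd : Differentiable ℝ W := hW.differentiable one_ne_zero
  set w : E3 := curl W y₀ with hw
  have hw2 : w 2 = 0 := curl_apply_two_eq_zero hax hsw hW y₀
  have hrot : curl W (rotZ (Real.pi / 2) y₀) = rotZ (Real.pi / 2) w := (hax.curl hWd) (Real.pi / 2) y₀
  have e1 := hd y₀
  have e2 := hd (rotZ (Real.pi / 2) y₀)
  rw [hrot] at e2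
  rw [← hw] at e1
  simp only [PiLp.inner_apply, RCLike.inner_apply, conj_trivial, Fin.sum_univ_three, rotZ_apply_zero, rotZ_apply_one,
    rotZ_apply_two, Real.cos_pi_div_two, Real.sin_pi_div_two, hw2] at e1 e2
  -- `w` is horizontal and nonzero
  have hne : w 0 ^ 2 + w 1 ^ 2 ≠ 0 := by
    intro h0
    apply hy₀
    have h00 : w 0 = 0 := by nlinarith [sq_nonneg (w 0), sq_nonneg (w 1)]
    have h11 : w 1 = 0 := by nlinarith [sq_nonneg (w 0), sq_nonneg (w 1)]
    ext i
    fin_cases i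
    · simpa [hw] using h00
    · simpa [hw] using h11
    · simpa [hw] using hw2
  constructor
  · have : (w 0 ^ 2 + w 1 ^ 2) * d 0 = 0 := by linear_combination (w 0) * e1 - (w 1) * e2
    exact (mul_eq_zero.1 this).resolve_left hne
  · have : (w 0 ^ 2 + w 1 ^ 2) * d 1 = 0 := by linear_combination (w 1) * e1 + (w 0) * e2
    exact (mul_eq_zero.1 this).resolve_left hne

/-! ### §4 Two independent horizontal vectors span the horizontal plane; Lagrange identities -/

/-- The planar Lagrange identity for HORIZONTAL vectors: `(a₀b₁ − a₁b₀)² = ‖a‖²‖b‖² − ⟪a, b⟫²`. [folklore] -/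
theorem sq_det_eq_of_horizontal {a b : E3} (ha : a 2 = 0) (hb : b 2 = 0) :
    (a 0 * b 1 - a 1 * b 0) ^ 2 = ‖a‖ ^ 2 * ‖b‖ ^ 2 - ⟪a, b⟫ ^ 2 := by
  rw [EuclideanSpace.real_norm_sq_eq, EuclideanSpace.real_norm_sq_eq]
  simp only [PiLp.inner_apply, RCLike.inner_apply, conj_trivial, Fin.sum_univ_three, ha, hb]
  ring

/-- **Cramer in the horizontal plane**: if `a, b` are horizontal with `a₀b₁ − a₁b₀ ≠ 0`, then a vector orthogonal to `a` and to `b` is orthogonal to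
every horizontal vector. [folklore] -/
theorem inner_eq_zero_of_horizontal_span {a b w d : E3} (ha : a 2 = 0) (hb : b 2 = 0) (hw : w 2 = 0)
    (hD : a 0 * b 1 - a 1 * b 0 ≠ 0) (hda : ⟪d, a⟫ = 0) (hdb : ⟪d, b⟫ = 0) : ⟪d, w⟫ = 0 := by
  simp only [PiLp.inner_apply, RCLike.inner_apply, conj_trivial, Fin.sum_univ_three, ha, hb, hw] at hda hdb ⊢
  -- `d₀, d₁` solve a nonsingular homogeneous `2 × 2` system
  have h0 : (a 0 * b 1 - a 1 * b 0) * d 0 = 0 := by linear_combination (b 1) * hda - (a 1) * hdb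
  have h1 : (a 0 * b 1 - a 1 * b 0) * d 1 = 0 := by linear_combination (a 0) * hdb - (b 0) * hda
  have hd0 : d 0 = 0 := (mul_eq_zero.1 h0).resolve_left hD
  have hd1 : d 1 = 0 := (mul_eq_zero.1 h1).resolve_left hD
  rw [hd0, hd1]
  ring

end Summit.NavierStokesRegularity.NavierStokesRegularity.Theorems.PoloidalLiouville.CellFlux

end
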